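import Summits.QuantumFields.BalabanUV.T4Continuum.Support.VariationalVectorFederbushPhys
import Summits.QuantumFields.BalabanUV.T4Continuum.Support.VariationalVectorFederbushLine

/-!
# T⁴ programme, spine node NE2 (U1a), lane P2 — SUPPLIER LEAF V-FED, file 5: the `hFED` binder (curl half) for PRODUCT line transports under the
# road's STANDARD binders (FED⁺'s site mismatch `m₀` + the operator plaquette defect `a`), physical units
# (`t4/skeletons/NE2-t4-ne2-p2.md` v0.15 §2.E row V-FED; cell `pub-balaban`)

NE2 formalisation swarm `b2b-balaban-t4-ne2-formalise-*`, leaf prover 01 GEN 5 (`prover-b2b-balaban-t4-ne2-formalise-leaf-01-g5-0`); the composition of file 3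
`VariationalVectorFederbushPhys.ScV_QvL_le_curl` (p217269: the `hFED` binder of `VariationalVectorForm.vector_pair_bracket_sqrt` for the pure curl form under
(M1) `‖misL‖ ≤ m`, (M2) comb defect `≤ w′`) with file 4 `VariationalVectorFederbushLine.{norm_misL_line_le, norm_pathL_sub_pathL_line_le}` (p217357: for product
line transports `lineT T′ R′ = T′(start) ∘ Π`, `m = m₀ + L·L·a` and `w′ = L·L·a`) — BY NAME, nothing else.

THE STATEMENT (model level; coarse level `n`, fine level `n·L`, one-step coordinates `Tor (fine L (fine n M))`; `E` any normed ℂ-space): coarse bond transports `Rc`,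
fine bond transports `R′` (`‖R′‖ ≤ 1`, operator plaquette defect `‖R′(x,κ)R′(x+e_κ,ι) − R′(x,ι)R′(x+e_ι,κ)‖ ≤ a`), site transports `T′` (`‖T′‖ ≤ 1`) with FED⁺'s
site mismatch `‖misv Rc R′ T′‖ ≤ m₀`, any `G′ ≥ 0`:
  **`ScV_QvL_line_le_curl`**: `ScV n M Rc 0 (QvL L (fine n M) (lineT T′ R′) W′) ≤ ( √(SfV n L M R′ G′ W′) + d·n·(2(m₀ + L²a) + 2L·(L²a))·√(qVV n L M W′) )²`
— `δ_curl = 2d·n·(m₀ + L²a + L³a)`; honest size under the scale-invariant class `(nL)²a ≤ c`, `m₀ ≲ C·L²·a` (taxi site transports): `δ_curl = O(L∕n)`,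
geometric along the tower.  WHAT IS NOT HERE: the size of `m₀`; the `G`-half (leaf V-GF).

HONEST FRAMING (T4-DAG p. 1).  Model level; transports DATA; composition only; nothing printed is a hypothesis; no `def`, no `def … : Prop`, no `sorry`; axioms
standard.  NE2 NOT proved; spine PROVED 0∕9 unchanged; rung (B)+1 finite T⁴ — NOT infinite volume, NOT mass gap, NOT Clay.  HONEST DEPENDENCY (cell, verbatim):
continuum YM on T⁴ ⇐ BetaPertH ∧ nine spine estimates (0/9 proved); BetaPertH ⇐ (D1) ∧ (D4) ∧ CAP+tail; G-an2-4 gates asym, D1 and NE2/3/4.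
-/

noncomputable section

namespace Summit.QuantumFields.BalabanUV.T4Continuum.VariationalVectorFederbush

open Literature.MathematicalPhysics.QuantumFieldTheory.Balaban1983to89
open Literature.MathematicalPhysics.QuantumFieldTheory.Balaban1983to89.B5Prop11Plancherel (Tor fine unitVec)
open Summit.QuantumFields.BalabanUV.T4Continuum.VariationalColourFederbush (misv)
open Summit.QuantumFields.BalabanUV.T4Continuum.VectorBlockTrialForm (QvL)
open Summit.QuantumFields.BalabanUV.T4Continuum.VariationalVectorForm (ScV SfV qVV)

variable {d : ℕ} {E : Type*} [NormedAddCommGroup E] [NormedSpace ℂ E]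
variable (n L : ℕ) [NeZero n] [NeZero L] (M : Fin d → ℕ) [hM : ∀ μ, NeZero (M μ)]

/-- **LEAF V-FED, CURL HALF, PRODUCT LINE TRANSPORTS, STANDARD BINDERS** (physical units):
`ScV n M Rc 0 (Q_{T′∘Π} W′) ≤ ( √(SfV n L M R′ G′ W′) + d·n·(2(m₀ + L²a) + 2L·(L²a))·√(qVV n L M W′) )²`. [folklore] -/
theorem ScV_QvL_line_le_curl {Rc : Tor (fine n M) → Fin d → (E →L[ℂ] E)} {R' : Tor (fine L (fine n M)) → Fin d → (E →L[ℂ] E)}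
    {T' : Tor (fine L (fine n M)) → (E →L[ℂ] E)} (hR' : ∀ x μ, ‖R' x μ‖ ≤ 1) (hT' : ∀ x, ‖T' x‖ ≤ 1) {m₀ a : ℝ} (hm₀ : 0 ≤ m₀) (ha0 : 0 ≤ a)
    (hmis : ∀ y μ j, ‖misv L (fine n M) Rc R' T' y μ j‖ ≤ m₀)
    (ha : ∀ x κ ι, ‖R' x κ * R' (x + unitVec (fine L (fine n M)) κ) ι - R' x ι * R' (x + unitVec (fine L (fine n M)) ι) κ‖ ≤ a)
    {G' : (Tor (fine L (fine n M)) → Fin d → E) → ℝ} (hG0' : ∀ W', 0 ≤ G' W') (W' : Tor (fine L (fine n M)) → Fin d → E) :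
    ScV n M Rc (fun _ => 0) (QvL L (fine n M) (lineT L (fine n M) T' R') W')
      ≤ (Real.sqrt (SfV n L M R' G' W')
          + (d : ℝ) * ((n : ℝ) * (2 * (m₀ + L * L * a) + 2 * L * (L * L * a))) * Real.sqrt (qVV n L M W')) ^ 2 :=
  ScV_QvL_le_curl n L M hR' (norm_lineT_le_one L (fine n M) hR' hT') (by positivity) (by positivity)
    (fun y j t μ ν => (norm_misL_line_le L (fine n M) hR' hT' ha y j t μ ν).trans (add_le_add (hmis y μ j) le_rfl))
    (fun y j s t μ ν => norm_pathL_sub_pathL_line_le L (fine n M) hR' hT' ha y j s t μ ν) hG0' W'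

end Summit.QuantumFields.BalabanUV.T4Continuum.VariationalVectorFederbush

end
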